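import Summits.BirchSwinnertonDyer.BirchSwinnertonDyer.Theses.MordellShaFreeCut

/-!
# `Assembly` of route `MordellShaFreeCut` (rung S2b) — proved

`Assembly : RankPosOfThreeSelmerCorankOne → AnalyticRankOneOfRankOneFiniteShaThree →
  Literature.NumberTheory.EllipticCurves.rankOne_threeConverse_mordellCurve`:
given `D ≠ 0` and `corank_{ℤ₃} Sel_{3^∞}(E_D) = 1`, crux A gives `rank ≥ 1`; the corank identity at `3`
forces `rank = 1` and `shaCorank 3 = 0`, i.e. `Finite (Ш[3^∞])`; crux B returns `analyticRank = 1`.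
-/

namespace Summit.BirchSwinnertonDyer.BirchSwinnertonDyer.Theorems.MordellShaFreeCutAssembly

open Literature.NumberTheory.EllipticCurves
open Summit.BirchSwinnertonDyer.BirchSwinnertonDyer.Theses.MordellShaFreeCut

/-- The route's `Assembly` item holds (closes `stmt-BirchSwinnertonDyer-19161`). -/
theorem assembly_holds :
    Summit.BirchSwinnertonDyer.BirchSwinnertonDyer.Theses.MordellShaFreeCut.Assembly := by
  intro hA hB D hD hcorank
  haveI := isElliptic_mordellCurve hD
  haveI : Fact (Nat.Prime 3) := ⟨Nat.prime_three⟩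
  have hadd := (mordellCurve D).selmerCorank_eq_mordellWeilRank_add_holds 3
  have hpos := hA hD hcorank
  have hrank : (mordellCurve D).mordellWeilRank = 1 := by omega
  have hsha : (mordellCurve D).shaCorank 3 = 0 := by omega
  exact hB hD hrank ((finite_primaryComponent_sha_iff_shaCorank_eq_zero _ 3).2 hsha)

end Summit.BirchSwinnertonDyer.BirchSwinnertonDyer.Theorems.MordellShaFreeCutAssembly
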